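import Literature.AlgebraicGeometry.HodgeTheory.HodgeGroupProductCMFactor
import Literature.AlgebraicGeometry.HodgeTheory.SimplePrimeDimensionHodgeClasses
import Literature.AlgebraicGeometry.HodgeTheory.AbelianVarietyPullbackAlgebraicClasses
import Literature.AlgebraicGeometry.HodgeTheory.HodgeTypeExteriorProduct
import Literature.AlgebraicGeometry.Milne1999.CMTypeProducts
import HarnessLib

/-!
# Hodge classes on `A × C`, `C` of CM type — II: the closed sub-classes by name (`B(A) = D(A)`; powers of simple abelian varieties of prime dimension; products of CM blocks) and EXACTNESS (`HC(A × C) ⟺ HC(A) ∧ HC(C)`; on every admissible slice `{A₀ × C : C of CM type}` the Hodge conjecture is EQUIVALENT to HC_CM)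

Family `hodge`, layer `Literature/AlgebraicGeometry/HodgeTheory`. Written for the cell `pub-hodge-ring2`
(route seat `motiv`, generation 2). HONEST FRAMING: research route conditional on HC_CM; not a corollary;
Q11.4-sentence-2 already refuted in dim ≥ 3. HC_CM (the Hodge conjecture for complex abelian varieties
of CM type, `∀ B, Milne1999.CMHodgeHypothesisAt B`) is a BINDER in every conditional theorem below and
is never asserted. No deformation / semiregularity transport is used anywhere in this file.

Sequel to `HodgeTheory/HodgeGroupProductCMFactor` (Lombardo 2016 Lemma 3.4 + Moonen–Zarhin 1999 §3:
for `A` without simple factor of type IV and `C` of CM type the Hodge group of `A × C` splits, so the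
Hodge classes of `A × C` are spanned by exterior products of Hodge classes of the factors — the named
fact `Lombardo2016_hodgeClassesProductSpan` — whence HC_CM ∧ HC(`A`) ⟹ HC(`A × C`),
`hodgeConjectureFor_prod_of_cmHodgeHypothesis`). That file closed the sub-classes `dim A ≤ 3`
(refereed) and `dim A ≤ 5` (on Markman's claim). This file adds:

## What is here

* `IsDivisorGenerated A` — van Geemen's "`B•(A) = D•(A)`" read on rational classes exactly as in the
  tree's `TankeevRibet1983_hodgeClasses_divisorial_powers_simplePrimeDimension` and
  `AbelianVariety.hodgeClasses_divisorial_of_oneOne`: every rational `(p,p)`-class of `H²ᵖ(A(ℂ); ℂ)`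
  lies in `Dᵖ(A) ⊗ ℂ = divisorClassesSpan A.X A.dim p` (the `ℂ`-span of `p`-fold cup products of
  rational `(1,1)`-classes, `Barriers/HodgeConjecture/ExceptionalHodgeClasses`). Van Geemen, LNM 1594,
  §2.4: "if `Dᵖ = Bᵖ`, then the Hodge `(p, p)`-conjecture is true for `X`" — PROVED here as
  `hodgeConjectureFor_of_isDivisorGenerated` (Lefschetz `(1,1)` is the tree's theorem
  `lefschetzOneOne_rational_holds`; products of divisor classes are algebraic on an abelian variety,
  `AbelianVariety.divisorClassesSpan_le_algebraicClasses`). Feeders: `isDivisorGenerated_powSucc_of_tankeevRibet`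
  (every power `X^{N+1}` of a simple abelian variety of prime dimension, modulo the named fact
  Tankeev 1982 / Ribet 1983 = Moonen–Zarhin 1999 Thm. (2.7)); in the tree the maximal-Picard-number
  THEOREM `AbelianVariety.hodgeClasses_divisorial_of_oneOne` (`HodgeTheory/MaximalPicardNumberHodgeClasses`,
  Tate–Murasaki) has literally the conclusion `IsDivisorGenerated A` unfolded (not imported here).
* CLOSED SUB-CLASSES of the product theorem, conditional on HC_CM and the span fact as binders:
  `hodgeConjectureFor_prod_of_cmHodgeHypothesis_of_isDivisorGenerated` (`A` with `B(A) = D(A)` and no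
  type-IV factor, `C` of CM type), `hodgeConjectureFor_powSucc_prod_of_cmHodgeHypothesis_of_tankeevRibet`
  (`X^{N+1} × C`, `X` simple of prime dimension, the power without type-IV factor — an explicit
  hypothesis: the tree's `End⁰` of a power is not computed from `End⁰(X)`), and
  `hodgeConjectureFor_prod_cmProd_of_cmHodgeHypothesis` (`A × (C₁ × C₂)` with `C₁`, `C₂` of CM type and
  positive-dimensional: `C₁ × C₂` is again of CM type by the tree's theorem
  `Milne1999.CMTypeProducts.isOfCMType_prod`, so ONE CM block of any length is reached honestly — in
  contrast to `hodgeConjectureFor_prod_prod_of_cmHodgeHypothesis` of the prequel, whose hypothesis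
  `HasNoTypeIVFactor (A.prod C₁)` is vacuous in practice).
* EXACTNESS (unconditional): `hodgeConjectureFor_left_of_prod`, `hodgeConjectureFor_right_of_prod` —
  HC(`A × C`) ⟹ HC(`A`) and HC(`C`), by restriction to the slices `A × {e}` and `{e} × C` (the slice is a
  section of the projection; the pullback of an algebraic class to a smooth projective variety mapping
  to an abelian variety is algebraic, the tree's theorem `map_mem_algebraicClasses_of_abelianVariety`,
  Fulton §19.2 Cor. 19.2 (b) + §10.1); hence `hodgeConjectureFor_prod_iff_of_productSpan`
  (HC(`A × C`) ⟺ HC(`A`) ∧ HC(`C`) whenever the Hodge classes of `A × C` are spanned by products) and the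
  class-level statement `forall_prod_cmType_iff_cmHodgeHypothesis`: for ANY single `A₀` without type-IV
  factor satisfying HC (e.g. `dim A₀ ≤ 3`), the Hodge conjecture on the slice `{A₀ × C : C of CM type}` is
  EQUIVALENT to HC_CM (modulo the span fact for `⟸`; `⟹` is unconditional,
  `cmHodgeHypothesisAt_of_hodgeConjectureFor_prod`). So HC_CM is exactly — no more, no less — what the
  Mumford–Tate / product line needs: it cannot be weakened on this class, and nothing on this class
  needs more.

## What is NOT here (honest content)

Every conditional theorem has content beyond the refereed record exactly when the CM factor `C` has
OPEN Hodge conjecture (CM abelian varieties of dimension `≥ 4` carrying exceptional = non-divisorial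
Hodge classes; `≤ 3` is Lefschetz, and by Moonen–Zarhin 1999 Thm. 0.1 a CM fourfold's exceptional classes
are Weil classes, algebraic in the cases of Schoen / van Geemen / Koike and, on Markman's claim, all of
them) — there the theorems say precisely "HC_CM at `C` ⟹ HC(`A × C`)", and `hodgeConjectureFor_right_of_prod`
says the converse. Products in which a NON-CM factor of type IV shares its centre with the CM factor
are not reached (the Hodge group does not split; Shioda's examples, `Shioda1981_exists_cmType_prod_not_productSpan`
of the prequel). Abdulali's domination theorems (LMS Lecture Notes 427 (2016) 292–307, Def. 3.1,
Prop. 3.2, Thms. 6.2, 6.5, 6.6: a type-IV abelian variety `A` of the kinds listed there is dominated by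
products `B × C`, `C` of CM type, so the GENERAL Hodge conjecture for `A` follows from the USUAL Hodge
conjecture for the non-split products `A × B × C`) are NOT consequences of HC_CM and are not rendered:
their input is the usual Hodge conjecture on products whose Hodge group does not split.

## References

* [Lombardo2016] D. Lombardo, Ann. Inst. Fourier 66 (2016) 1217–1245, Lemma 3.4 (p. 1229) (= Lemma 35 of arXiv:1402.1478).
* [MoonenZarhin1999LowDim] B. Moonen, Yu. Zarhin, Math. Ann. 315 (1999) 711–733: §3 (3.1), Thm. (2.7), Thm. 0.1.
* [vanGeemen1994HodgeAV] B. van Geemen, LNM 1594 (1994) 233–252: §2.4–2.5 (`B`, `D`, "if `Dᵖ = Bᵖ` …"), Thm. 4.3 (Tate), Thm. 4.6 (Tankeev–Ribet), Thm. 4.11.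
* [Tankeev1983], [Ribet1983] (the prime-dimension theorem, vendored in `SimplePrimeDimensionHodgeClasses`).
* [Milne1999] J. S. Milne, Compositio Math. 117 (1999), §7 p. 72 (the hypothesis HC_CM).
* [Fulton1998] W. Fulton, Intersection Theory, §19.2 Cor. 19.2 (b), §10.1 (slices and pullback of cycles).
* [Abdulali2016TateTwists] S. Abdulali, in: Recent Advances in Hodge Theory (Kerr, Pearlstein eds.), LMS LN 427 (2016) 292–307, §3, §6.
* [Deligne2000] P. Deligne, The Hodge conjecture (Clay problem statement), §1.
-/

noncomputable section

open CategoryTheory MonoidalCategory CartesianMonoidalCategory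
open Literature.AlgebraicTopology.SingularHomology
open Literature.AlgebraicGeometry.Motives
open Literature.Barriers.HodgeConjecture

namespace Literature.AlgebraicGeometry.HodgeTheory

section HodgeTheory

/-! ### `B(A) = D(A)`: the Hodge ring is generated by divisor classes -/

/-- **`B•(A) = D•(A)` — the Hodge ring of the complex abelian variety `A` is generated by divisor
classes** (van Geemen, LNM 1594, §2.4–2.5: `B = ⊕ Bᵖ` the Hodge classes, `D` the subring generated by
`B⁰` and `B¹`), read on rational classes with `ℂ`-coefficients exactly as in the tree's
`TankeevRibet1983_hodgeClasses_divisorial_powers_simplePrimeDimension`: every RATIONAL class of Hodge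
type `(p,p)` in `H²ᵖ(A(ℂ); ℂ)` lies in `divisorClassesSpan A.X A.dim p = Dᵖ(A) ⊗ ℂ`, the `ℂ`-span of the
`p`-fold cup products of rational `(1,1)`-classes. A predicate on `A` (false for a general abelian
variety of Weil type, `Weil1977_exceptionalHodgeClasses`). [cite: vanGeemen1994HodgeAV, §2.4–2.5] -/
def IsDivisorGenerated (A : AbelianVariety ℂ) : Prop :=
  ∀ (p : ℕ) (c : complexBetti A.X (2 * p)), IsRationalClass c →
    IsOfHodgeType A.dim A.X (2 * p) p p c → c ∈ divisorClassesSpan A.X A.dim p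

/-- Unfolding of `IsDivisorGenerated`. [cite: vanGeemen1994HodgeAV, §2.4–2.5] -/
theorem isDivisorGenerated_iff (A : AbelianVariety ℂ) :
    IsDivisorGenerated A ↔ ∀ (p : ℕ) (c : complexBetti A.X (2 * p)), IsRationalClass c →
      IsOfHodgeType A.dim A.X (2 * p) p p c → c ∈ divisorClassesSpan A.X A.dim p :=
  Iff.rfl

/-- **Van Geemen §2.4: "if `Dᵖ = Bᵖ`, then the Hodge `(p, p)`-conjecture is true for `X`"** — PROVED,
unconditionally, in the summit layer's spelling: `B(A) = D(A)` gives `HodgeConjectureFor A.dim A.X`.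
Rational `(1,1)`-classes are algebraic (Lefschetz `(1,1)`, the tree's theorem
`lefschetzOneOne_rational_holds`), cup products of divisor classes are algebraic on an abelian variety
(`AbelianVariety.divisorClassesSpan_le_algebraicClasses`), and Hodge models exist
(`nonempty_hodgeModel_holds`; abelian varieties are smooth projective, `AbelianVariety.isSmoothProjective_holds`).
[cite: vanGeemen1994HodgeAV, §2.4] -/
theorem hodgeConjectureFor_of_isDivisorGenerated (A : AbelianVariety ℂ) (hD : IsDivisorGenerated A) :
    HodgeConjectureFor A.dim A.X :=
  ⟨nonempty_hodgeModel_holds (Motives.AbelianVariety.isSmoothProjective_holds (A := A)),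
    fun p c hc hpp ↦ AbelianVariety.divisorClassesSpan_le_algebraicClasses A
      (fun b hb hb' ↦ lefschetzOneOne_rational_holds
        (Motives.AbelianVariety.isSmoothProjective_holds (A := A)) b hb hb') p (hD p c hc hpp)⟩

/-- **Feeder (Tankeev 1982 / Ribet 1983 = Moonen–Zarhin 1999 Thm. (2.7), named fact):** every power
`X^{N+1} = X.powSucc N` of a simple complex abelian variety `X` of prime dimension has `B = D`.
[cite: MoonenZarhin1999LowDim, §2 Thm. (2.7)] [cite: vanGeemen1994HodgeAV, Thm. 4.6] -/
theorem isDivisorGenerated_powSucc_of_tankeevRibet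
    (h : TankeevRibet1983_hodgeClasses_divisorial_powers_simplePrimeDimension)
    (X : AbelianVariety ℂ) {p : ℕ} (hp : p.Prime) (hX : X.dim = p) (hs : X.IsSimple) (N : ℕ) :
    IsDivisorGenerated (X.powSucc N) :=
  fun m c hc hmm ↦ h X p hp hX hs N m c hc hmm

/-! ### Closed sub-classes of the product theorem (HC_CM and the span fact as binders) -/

/-- **Closed class `B(A) = D(A)`.** HC_CM (binder `hCM`) and the Lombardo–Moonen–Zarhin span fact
(binder `hL`) give the Hodge conjecture for `A × C` whenever `A` has no simple factor of type IV and
divisor-generated Hodge ring, and `C` is of CM type (any dimension): HC(`A`) is the unconditional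
`hodgeConjectureFor_of_isDivisorGenerated`. In print this class contains `A` = a product of elliptic
curves (Tate, van Geemen Thm. 4.3; no type IV forces the curves non-CM), `A` = a power of a simple
abelian variety of prime dimension of types I–III (Tankeev–Ribet, Thm. 4.6), `A` with `End⁰(A) = ℚ`
general (Mattuck; `B(A) = D(A) = ℚ[E]`). HONEST FRAMING: research route conditional on HC_CM; not a
corollary; content beyond the record only when HC(`C`) is open.
[cite: Lombardo2016, Lemma 3.4 (p. 1229; = Lemma 35 of arXiv:1402.1478)] [cite: vanGeemen1994HodgeAV, §2.4 and Thms. 4.3, 4.6] -/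
theorem hodgeConjectureFor_prod_of_cmHodgeHypothesis_of_isDivisorGenerated
    (hCM : ∀ B : AbelianVariety ℂ, Milne1999.CMHodgeHypothesisAt B)
    (hL : Lombardo2016_hodgeClassesProductSpan) (A C : AbelianVariety ℂ)
    (hA4 : HasNoTypeIVFactor A) (hCt : Milne1999.IsOfCMType C) (hD : IsDivisorGenerated A) :
    HodgeConjectureFor (A.prod C).dim (A.prod C).X :=
  hodgeConjectureFor_prod_of_cmHodgeHypothesis hCM hL A C hA4 hCt
    (hodgeConjectureFor_of_isDivisorGenerated A hD)

/-- **Closed class: powers of simple abelian varieties of prime dimension times a CM factor.** Under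
HC_CM (`hCM`), the span fact (`hL`) and Tankeev–Ribet (`hT`, Moonen–Zarhin 1999 Thm. (2.7)), for `X`
simple of prime dimension `p`, every `N`, and `C` of CM type: if the power `X^{N+1}` has no simple factor
of type IV (explicit hypothesis `h4` — it holds iff `X` is of type I, II or III, e.g. `End⁰(X) = ℚ`, but
the tree's `End⁰(X^{N+1})` is not computed from `End⁰(X)`, so it is not derived here), then the Hodge
conjecture holds for `X^{N+1} × C`. [cite: MoonenZarhin1999LowDim, §2 Thm. (2.7) and §3 (3.1)]
[cite: Lombardo2016, Lemma 3.4 (p. 1229; = Lemma 35 of arXiv:1402.1478)] -/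
theorem hodgeConjectureFor_powSucc_prod_of_cmHodgeHypothesis_of_tankeevRibet
    (hCM : ∀ B : AbelianVariety ℂ, Milne1999.CMHodgeHypothesisAt B)
    (hL : Lombardo2016_hodgeClassesProductSpan)
    (hT : TankeevRibet1983_hodgeClasses_divisorial_powers_simplePrimeDimension)
    (X : AbelianVariety ℂ) {p : ℕ} (hp : p.Prime) (hX : X.dim = p) (hs : X.IsSimple) (N : ℕ)
    (C : AbelianVariety ℂ) (h4 : HasNoTypeIVFactor (X.powSucc N)) (hCt : Milne1999.IsOfCMType C) :
    HodgeConjectureFor ((X.powSucc N).prod C).dim ((X.powSucc N).prod C).X :=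
  hodgeConjectureFor_prod_of_cmHodgeHypothesis_of_isDivisorGenerated hCM hL (X.powSucc N) C h4 hCt
    (isDivisorGenerated_powSucc_of_tankeevRibet hT X hp hX hs N)

/-- **Closed class: one CM block of length two, honestly.** Under HC_CM and the span fact, for `A`
without type-IV factor satisfying HC and `C₁`, `C₂` of CM type of positive dimension, the Hodge
conjecture holds for `A × (C₁ × C₂)`: the product `C₁ × C₂` is again of CM type (the tree's theorem
`Milne1999.CMTypeProducts.isOfCMType_prod`: the product subalgebra `S₁ × S₂ ⊆ End⁰(C₁ × C₂)` is
commutative reduced of rank `2 dim C₁ + 2 dim C₂`), so the one-block theorem applies to the pair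
`(A, C₁ × C₂)`. By induction any finite CM block `C₁ × ⋯ × C_r` is reached the same way.
[cite: Milne1999, §1 (products of CM abelian varieties are CM)] [cite: Lombardo2016, Lemma 3.4 (p. 1229; = Lemma 35 of arXiv:1402.1478)] -/
theorem hodgeConjectureFor_prod_cmProd_of_cmHodgeHypothesis
    (hCM : ∀ B : AbelianVariety ℂ, Milne1999.CMHodgeHypothesisAt B)
    (hL : Lombardo2016_hodgeClassesProductSpan) (A C₁ C₂ : AbelianVariety ℂ)
    (hA4 : HasNoTypeIVFactor A) (hC₁ : Milne1999.IsOfCMType C₁) (hC₂ : Milne1999.IsOfCMType C₂)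
    (h₁ : 0 < C₁.dim) (h₂ : 0 < C₂.dim) (hA : HodgeConjectureFor A.dim A.X) :
    HodgeConjectureFor (A.prod (C₁.prod C₂)).dim (A.prod (C₁.prod C₂)).X :=
  hodgeConjectureFor_prod_of_cmHodgeHypothesis hCM hL A (C₁.prod C₂) hA4
    (Milne1999.CMTypeProducts.isOfCMType_prod hC₁ hC₂ h₁ h₂) hA

/-- The CM-block class with `dim A ≤ 3` (refereed inputs only besides the binders): HC_CM and the span
fact give the Hodge conjecture for `A × (C₁ × C₂)`, `A` without type-IV factor of dimension `≤ 3`,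
`C₁`, `C₂` of CM type of positive dimension. [cite: MoonenZarhin1999LowDim, Introduction and §3] -/
theorem hodgeConjectureFor_prod_cmProd_of_cmHodgeHypothesis_of_dim_le_three
    (hCM : ∀ B : AbelianVariety ℂ, Milne1999.CMHodgeHypothesisAt B)
    (hL : Lombardo2016_hodgeClassesProductSpan) (A C₁ C₂ : AbelianVariety ℂ) (hd : A.dim ≤ 3)
    (hA4 : HasNoTypeIVFactor A) (hC₁ : Milne1999.IsOfCMType C₁) (hC₂ : Milne1999.IsOfCMType C₂)
    (h₁ : 0 < C₁.dim) (h₂ : 0 < C₂.dim) :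
    HodgeConjectureFor (A.prod (C₁.prod C₂)).dim (A.prod (C₁.prod C₂)).X :=
  hodgeConjectureFor_prod_cmProd_of_cmHodgeHypothesis hCM hL A C₁ C₂ hA4 hC₁ hC₂ h₁ h₂
    (hodgeConjectureFor_of_dim_le_three_holds hd (Motives.AbelianVariety.isSmoothProjective_holds (A := A)))

/-! ### Exactness: HC(`A × C`) ⟹ HC(`A`) ∧ HC(`C`) (unconditional), and the slice `{A₀ × C}` -/

/-- **HC(`A × C`) ⟹ HC(`A`)**, unconditionally. A rational `(p,p)`-class `a` on `A` pulls back along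
`pr_A` to a rational `(p,p)`-class on `A × C` (`IsRationalClass.pullback`,
`IsOfHodgeType.map_of_isSmoothProjective`), algebraic by hypothesis; its restriction to the slice
`i_e : A ≅ A × {e} ↪ A × C` (`Motives.sliceAt`, `e` the origin of `C(ℂ)`) is algebraic (pullback of an
algebraic class along a morphism from a smooth projective variety to an abelian variety, the tree's theorem
`map_mem_algebraicClasses_of_abelianVariety`), and `i_e ≫ pr_A = 𝟙` gives back `a`. (The summit-side
file `Theorems/Ring2TransportWeilTypeExactness` has the same statement, `Ring2Transport.hodgeConjectureFor_of_prod`,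
proved through a GENERAL slice of smooth projective `X × Y`; this Literature-level copy, needed by the `iff`
below, slices at the origin and uses the abelian-variety pullback theorem instead.)
[cite: Fulton1998, §19.2 Cor. 19.2 (b) and §10.1] -/
theorem hodgeConjectureFor_left_of_prod (A C : AbelianVariety ℂ)
    (h : HodgeConjectureFor (A.prod C).dim (A.prod C).X) : HodgeConjectureFor A.dim A.X := by
  have hAsp : IsSmoothProjective A.dim A.X := Motives.AbelianVariety.isSmoothProjective_holds
  have hACsp : IsSmoothProjective (A.prod C).dim (A.prod C).X :=
    Motives.AbelianVariety.isSmoothProjective_holds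
  refine ⟨nonempty_hodgeModel_holds hAsp, fun p a ha hpp ↦ ?_⟩
  -- pull back to `A × C` along the first projection
  have hb : complexBetti.map (fst A.X C.X) (2 * p) a ∈ algebraicClasses (A.prod C).X p :=
    h.2 p (complexBetti.map (fst A.X C.X) (2 * p) a) (ha.pullback _)
      (hpp.map_of_isSmoothProjective hACsp hAsp (fst A.X C.X))
  -- restrict to the slice `A × {1}`
  have key := map_mem_algebraicClasses_of_abelianVariety hAsp (A.prod C)
    (sliceAt A.X (1 : C.Points ℂ)) hb
  have hcomp : complexBetti.map (sliceAt A.X (1 : C.Points ℂ)) (2 * p)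
      (complexBetti.map (fst A.X C.X) (2 * p) a) = a := by
    change (complexBetti.map (fst A.X C.X) (2 * p) ≫
      complexBetti.map (sliceAt A.X (1 : C.Points ℂ)) (2 * p)) a = a
    rw [← complexBetti.map_comp, sliceAt_fst, complexBetti.map_id]
    rfl
  exact (congrArg (· ∈ algebraicClasses A.X p) hcomp).mp key

/-- **HC(`A × C`) ⟹ HC(`C`)**, unconditionally — the same with the slice `{e} × C ↪ A × C`
(`lift (const e) (𝟙 C)`, a section of `pr_C`). In particular the Hodge conjecture for products with a
CM factor `C` IMPLIES Milne's hypothesis at `C`: HC_CM cannot be weakened on this class.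
[cite: Fulton1998, §19.2 Cor. 19.2 (b) and §10.1] -/
theorem hodgeConjectureFor_right_of_prod (A C : AbelianVariety ℂ)
    (h : HodgeConjectureFor (A.prod C).dim (A.prod C).X) : HodgeConjectureFor C.dim C.X := by
  have hCsp : IsSmoothProjective C.dim C.X := Motives.AbelianVariety.isSmoothProjective_holds
  have hACsp : IsSmoothProjective (A.prod C).dim (A.prod C).X :=
    Motives.AbelianVariety.isSmoothProjective_holds
  refine ⟨nonempty_hodgeModel_holds hCsp, fun p b hb hpp ↦ ?_⟩
  -- the slice `{1} × C`
  let i : C.X ⟶ A.X ⊗ C.X :=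
    CartesianMonoidalCategory.lift (toSpecOver C.X ≫ (1 : A.Points ℂ)) (𝟙 C.X)
  have hi : i ≫ snd A.X C.X = 𝟙 C.X := CartesianMonoidalCategory.lift_snd _ _
  have hb' : complexBetti.map (snd A.X C.X) (2 * p) b ∈ algebraicClasses (A.prod C).X p :=
    h.2 p (complexBetti.map (snd A.X C.X) (2 * p) b) (hb.pullback _)
      (hpp.map_of_isSmoothProjective hACsp hCsp (snd A.X C.X))
  have key := map_mem_algebraicClasses_of_abelianVariety hCsp (A.prod C) i hb'
  have hcomp : complexBetti.map i (2 * p) (complexBetti.map (snd A.X C.X) (2 * p) b) = b := by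
    change (complexBetti.map (snd A.X C.X) (2 * p) ≫ complexBetti.map i (2 * p)) b = b
    rw [← complexBetti.map_comp, hi, complexBetti.map_id]
    rfl
  exact (congrArg (· ∈ algebraicClasses C.X p) hcomp).mp key

/-- **Necessity of HC_CM at the CM factor**: the Hodge conjecture for any one product `A × C` gives
Milne's hypothesis `CMHodgeHypothesisAt C` (indeed HC(`C`) outright). [cite: Milne1999, §7 p. 72] -/
theorem cmHodgeHypothesisAt_of_hodgeConjectureFor_prod (A C : AbelianVariety ℂ)
    (h : HodgeConjectureFor (A.prod C).dim (A.prod C).X) : Milne1999.CMHodgeHypothesisAt C :=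
  fun _ _ ↦ hodgeConjectureFor_right_of_prod A C h

/-- **Exactness of the product theorem**: when the Hodge classes of `A × C` are spanned by exterior
products of Hodge classes of the factors (`HodgeClassesProductSpan A C`, e.g. `A` without type-IV factor
and `C` of CM type, by the span fact), the Hodge conjecture for `A × C` is EQUIVALENT to the conjunction
of the Hodge conjectures for `A` and for `C`. (`⟸` is `hodgeConjectureFor_prod_of_productSpan` of the
prequel; `⟹` is unconditional and does not use the span hypothesis.)
[cite: MoonenZarhin1999LowDim, §3 (3.1)] [cite: Fulton1998, §19.2 Cor. 19.2 (b)] -/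
theorem hodgeConjectureFor_prod_iff_of_productSpan (A C : AbelianVariety ℂ)
    (hS : HodgeClassesProductSpan A C) :
    HodgeConjectureFor (A.prod C).dim (A.prod C).X ↔
      HodgeConjectureFor A.dim A.X ∧ HodgeConjectureFor C.dim C.X :=
  ⟨fun h ↦ ⟨hodgeConjectureFor_left_of_prod A C h, hodgeConjectureFor_right_of_prod A C h⟩,
    fun h ↦ hodgeConjectureFor_prod_of_productSpan A C hS h.1 h.2⟩

/-- **The same under the span FACT, for `A` without type-IV factor and `C` of CM type**: HC(`A × C`) ⟺
HC(`A`) ∧ HC(`C`). [cite: Lombardo2016, Lemma 3.4 (p. 1229; = Lemma 35 of arXiv:1402.1478)] -/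
theorem hodgeConjectureFor_prod_iff_of_lombardo (hL : Lombardo2016_hodgeClassesProductSpan)
    (A C : AbelianVariety ℂ) (hA4 : HasNoTypeIVFactor A) (hCt : Milne1999.IsOfCMType C) :
    HodgeConjectureFor (A.prod C).dim (A.prod C).X ↔
      HodgeConjectureFor A.dim A.X ∧ HodgeConjectureFor C.dim C.X :=
  hodgeConjectureFor_prod_iff_of_productSpan A C (hL A C hA4 hCt)

/-- **HC_CM is EQUIVALENT to the Hodge conjecture on every admissible slice.** Fix ONE complex abelian
variety `A₀` without simple factor of type IV satisfying the Hodge conjecture (e.g. any `A₀` of dimension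
`≤ 3` with centre of `End⁰` equal to `ℚ`). Then, modulo the span fact (binder `hL`, used only for `⟸`):
the Hodge conjecture holds for all products `A₀ × C` with `C` of CM type IF AND ONLY IF HC_CM holds
(`∀ C, Milne1999.CMHodgeHypothesisAt C`, the summit item `RankFourFaces.CMAbelianHodge` by `Iff.rfl`).
So on the class reached by the Mumford–Tate / CM-factor line, HC_CM is exactly the missing input.
HONEST FRAMING: research route conditional on HC_CM; not a corollary; neither side is asserted.
[cite: Lombardo2016, Lemma 3.4 (p. 1229; = Lemma 35 of arXiv:1402.1478)] [cite: Milne1999, §7 p. 72] -/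
theorem forall_prod_cmType_iff_cmHodgeHypothesis (hL : Lombardo2016_hodgeClassesProductSpan)
    (A₀ : AbelianVariety ℂ) (h₀4 : HasNoTypeIVFactor A₀) (h₀ : HodgeConjectureFor A₀.dim A₀.X) :
    (∀ C : AbelianVariety ℂ, Milne1999.IsOfCMType C → HodgeConjectureFor (A₀.prod C).dim (A₀.prod C).X) ↔
      ∀ C : AbelianVariety ℂ, Milne1999.CMHodgeHypothesisAt C :=
  ⟨fun h C _ hC ↦ hodgeConjectureFor_right_of_prod A₀ C (h C hC),
    fun h C hC ↦ hodgeConjectureFor_prod_of_cmHodgeHypothesis h hL A₀ C h₀4 hC h₀⟩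

/-- The slice statement with `dim A₀ ≤ 3` (HC(`A₀`) discharged by the tree's unconditional
`hodgeConjectureFor_of_dim_le_three_holds`): for any `A₀` of dimension `≤ 3` without type-IV factor,
HC on `{A₀ × C : C of CM type}` ⟺ HC_CM, modulo the span fact.
[cite: MoonenZarhin1999LowDim, Introduction and §3 (3.1)] -/
theorem forall_prod_cmType_iff_cmHodgeHypothesis_of_dim_le_three
    (hL : Lombardo2016_hodgeClassesProductSpan) (A₀ : AbelianVariety ℂ) (hd : A₀.dim ≤ 3)
    (h₀4 : HasNoTypeIVFactor A₀) :
    (∀ C : AbelianVariety ℂ, Milne1999.IsOfCMType C → HodgeConjectureFor (A₀.prod C).dim (A₀.prod C).X) ↔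
      ∀ C : AbelianVariety ℂ, Milne1999.CMHodgeHypothesisAt C :=
  forall_prod_cmType_iff_cmHodgeHypothesis hL A₀ h₀4
    (hodgeConjectureFor_of_dim_le_three_holds hd (Motives.AbelianVariety.isSmoothProjective_holds (A := A₀)))

/-- **Unconditional necessity, class level**: if the Hodge conjecture holds for every self-product
`C × C` of a CM abelian variety, then HC_CM holds (slice `{e} × C`). No span fact, no hypothesis on
types. [cite: Fulton1998, §19.2 Cor. 19.2 (b)] -/
theorem cmHodgeHypothesis_of_forall_sq
    (h : ∀ C : AbelianVariety ℂ, Milne1999.IsOfCMType C → HodgeConjectureFor (C.prod C).dim (C.prod C).X) :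
    ∀ C : AbelianVariety ℂ, Milne1999.CMHodgeHypothesisAt C :=
  fun C _ hC ↦ hodgeConjectureFor_right_of_prod C C (h C hC)

/-! ### On-path lemmas: every target is a case of the Hodge conjecture -/

/-- **On path**: the Hodge conjecture for all smooth projective complex varieties gives every target of
this file — here the CM-block product `A × (C₁ × C₂)` (abelian varieties are smooth projective).
[cite: Deligne2000, §1] -/
theorem hodgeConjectureFor_prod_cmProd_of_hodgeConjecture
    (h : ∀ ⦃n : ℕ⦄ ⦃X : Motives.SchemeOver ℂ⦄, Motives.IsSmoothProjective n X → HodgeConjectureFor n X)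
    (A C₁ C₂ : AbelianVariety ℂ) :
    HodgeConjectureFor (A.prod (C₁.prod C₂)).dim (A.prod (C₁.prod C₂)).X :=
  h Motives.AbelianVariety.isSmoothProjective_holds

/-- **On path**: the Hodge conjecture gives `B = D ⟹ HC` trivially and, more to the point, both sides of
`forall_prod_cmType_iff_cmHodgeHypothesis` (so the equivalence claims nothing beyond the summit statement on
either side). [cite: Deligne2000, §1] -/
theorem forall_prod_cmType_of_hodgeConjecture
    (h : ∀ ⦃n : ℕ⦄ ⦃X : Motives.SchemeOver ℂ⦄, Motives.IsSmoothProjective n X → HodgeConjectureFor n X)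
    (A₀ : AbelianVariety ℂ) :
    ∀ C : AbelianVariety ℂ, Milne1999.IsOfCMType C → HodgeConjectureFor (A₀.prod C).dim (A₀.prod C).X :=
  fun _ _ ↦ h Motives.AbelianVariety.isSmoothProjective_holds

end HodgeTheory

end Literature.AlgebraicGeometry.HodgeTheory

end
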